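import Mathlib
import HarnessLib
import Literature.Probability.LatticeModels.IsingThermodynamics
import Summits.CriticalPhenomena.Ising3DConformalLimit.Theorems.PrecisionLaplacianDirectCorrelationStableTailScaleRegularityAux
import Summits.CriticalPhenomena.Ising3DConformalLimit.Theorems.PrecisionLaplacianDirectCorrelationStableTailPickInversionAux12
import Summits.CriticalPhenomena.Ising3DConformalLimit.Theorems.PrecisionLaplacianDirectCorrelationStableTailSlabModeExpDecayPaleyWienerAux

/-!
# Strip analyticity of the slab generating function ⇒ exponential decay of the slab modes
# (sub-stub `stub_slabModeExpDecay_auxPaleyWiener` of line `self-energy-pick-inversion`)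

Crux `PrecisionLaplacian.DirectCorrelationStableTail` (stmt-CriticalPhenomena-4799), parent stub
`stub_slabModeExpDecay` (the TRANSVERSE MASS GAP `HasSlabModeExpDecay dcf`).  This file is its last,
purely harmonic-analytic step (no Ising input).  For a summable `a : ℤ³ → ℝ`, a direction `i` and a
transverse momentum `k ∈ ℝ²`, the SLAB GENERATING FUNCTION is the real `2π`-periodic function
`Ψ(θ) = Σ_x a(x) cos(θ x_i + k·x_⊥)` (`x_⊥ = x ∘ succAbove i`), and the slab modes are
`α_n(k) = Σ_{y ∈ ℤ²} a(ins_i(n, y)) cos(k·y)`.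

* `integral_Icc_cos_intCast_add`, `integral_Icc_cos_add_mul_cos`: orthogonality on `[-π, π]` with a
  phase, `∫ cos(tm + φ) cos(nt) dt = π cos φ ([m = n] + [m = -n])`;
* `tsum_ite_apply_eq_tsum_slab`: a lattice sum restricted to the slab `{x_i = m}` is the sum over
  `y ↦ ins_i(m, y)`;
* `integral_slabGenerating_mul_cos`: COEFFICIENT EXTRACTION — if `a` is even in the `i`-th
  coordinate, `∫_{-π}^{π} Ψ(θ) cos(nθ) dθ = 2π α_n(k)` (swap `∫` and `Σ'` by the `ℓ¹` bound; only the
  slabs `x_i = ±n` survive);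
* `abs_slabMode_le_tsum_abs`: the trivial bound `|α_n(k)| ≤ ‖a‖_{ℓ¹}`;
* `slabMode_le_exp_of_strip`: if `a` is sign-flip invariant and for every reduced `k ≠ 0` the
  generating function is the trace of a function holomorphic on the strip `{|Im z| < c‖k‖}`, then
  `HasSlabModeExpDecay a` (expanded) holds with the same constant `c`: for `k ≠ 0` the extension is
  periodic and bounded on closed sub-strips (`exists_norm_le_of_strip`), and the extraction combined
  with the Paley–Wiener bound of the auxiliary file (`abs_integral_mul_cos_le_of_strip`:
  `|∫ Ψ cos(nθ)| ≤ 2π M e^{-c'‖k‖n}`) gives `α_n(k) ≤ M e^{-c'‖k‖n}`; for `k = 0` the trivial bound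
  suffices;
* `stub_slabModeExpDecay_auxPaleyWiener` (registered): the same with the (redundant) boundedness of
  the extension on closed sub-strips among the hypotheses, verbatim as briefed.

Pure theorem file, no definitions.  Sources: folklore (Paley–Wiener for Fourier series);
Y. Katznelson, *An Introduction to Harmonic Analysis*, I.4.
-/

noncomputable section

namespace Summit.CriticalPhenomena.Ising3DConformalLimit.Cruxes.DirectCorrelationStableTail.SelfEnergyPickInversion

open MeasureTheory Filter Topology
open scoped BigOperators Real
open Literature.Probability.LatticeModels

/-! ### Orthogonality on `[-π, π]` with a phase -/

/-- `∫_{[-π,π]} cos(t p + φ) dt = 2π cos φ · [p = 0]` for an integer frequency `p`. [folklore] -/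
theorem integral_Icc_cos_intCast_add (p : ℤ) (φ : ℝ) :
    ∫ t in Set.Icc (-π) π, Real.cos (t * p + φ) = if p = 0 then 2 * π * Real.cos φ else 0 := by
  have h1 : ∀ t : ℝ, Real.cos (t * p + φ) =
      Real.cos φ * Real.cos (t * p) - Real.sin φ * Real.sin (t * p) := by
    intro t; rw [Real.cos_add]; ring
  simp_rw [h1]
  rw [integral_sub, integral_const_mul, integral_const_mul, integral_Icc_cos_mul_intCast,
    integral_Icc_sin_mul_intCast]
  · split_ifs <;> ring
  · exact (Continuous.integrableOn_Icc (by fun_prop))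
  · exact (Continuous.integrableOn_Icc (by fun_prop))

/-- `∫_{[-π,π]} cos(t m + φ) cos(n t) dt = π cos φ ([m = n] + [m = -n])` for `m ∈ ℤ`, `n ∈ ℕ`
(product-to-sum and `integral_Icc_cos_intCast_add`). [folklore] -/
theorem integral_Icc_cos_add_mul_cos (m : ℤ) (φ : ℝ) (n : ℕ) :
    ∫ t in Set.Icc (-π) π, Real.cos (t * m + φ) * Real.cos (n * t) =
      π * Real.cos φ * ((if m = n then 1 else 0) + (if m = -(n : ℤ) then 1 else 0)) := by
  have key : ∀ A B : ℝ, Real.cos A * Real.cos B = 1 / 2 * (Real.cos (A - B) + Real.cos (A + B)) := by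
    intro A B
    rw [Real.cos_sub, Real.cos_add]
    ring
  have h1 : ∀ t : ℝ, Real.cos (t * m + φ) * Real.cos (n * t) =
      1 / 2 * (Real.cos (t * ((m - n : ℤ) : ℝ) + φ) + Real.cos (t * ((m + n : ℤ) : ℝ) + φ)) := by
    intro t
    rw [key, show t * m + φ - n * t = t * ((m - n : ℤ) : ℝ) + φ by push_cast; ring,
      show t * m + φ + n * t = t * ((m + n : ℤ) : ℝ) + φ by push_cast; ring]
  simp_rw [h1]
  rw [integral_const_mul, integral_add (Continuous.integrableOn_Icc (by fun_prop))
    (Continuous.integrableOn_Icc (by fun_prop)), integral_Icc_cos_intCast_add,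
    integral_Icc_cos_intCast_add]
  simp only [sub_eq_zero, add_eq_zero_iff_eq_neg]
  split_ifs <;> ring

/-! ### Lattice sums restricted to a slab -/

/-- A lattice sum restricted to the slab `{x_i = m}` is the sum over the slab parametrisation
`y ↦ ins_i(m, y)`. [folklore] -/
theorem tsum_ite_apply_eq_tsum_slab (F : Site 3 → ℝ) (i : Fin 3) (m : ℤ) :
    ∑' x : Site 3, (if x i = m then F x else 0) =
      ∑' y : Fin 2 → ℤ, F (Fin.insertNth i m y : Site 3) := by
  have hinj : Function.Injective (fun y : Fin 2 → ℤ => (Fin.insertNth i m y : Site 3)) :=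
    Fin.insertNth_right_injective (α := fun _ : Fin 3 => ℤ) (p := i) m
  have h := hinj.tsum_eq (f := fun x : Site 3 => if x i = m then F x else 0) (by
    intro x hx
    rw [Function.mem_support] at hx
    have hxi : x i = m := by
      by_contra h
      exact hx (if_neg h)
    exact ⟨i.removeNth x, by rw [← hxi]; exact Fin.insertNth_self_removeNth i x⟩)
  rw [← h]
  simp [Fin.insertNth_apply_same]

/-- The trivial bound on a slab mode: `|Σ_y a(ins_i(m, y)) cos(k·y)| ≤ Σ_x |a(x)|`. [folklore] -/
theorem abs_slabMode_le_tsum_abs {a : Site 3 → ℝ} (ha : Summable a) (i : Fin 3) (m : ℤ)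
    (k : Fin 2 → ℝ) :
    |∑' y : Fin 2 → ℤ, a (Fin.insertNth i m y : Site 3) * Real.cos (∑ j, k j * (y j : ℝ))| ≤
      ∑' x : Site 3, |a x| := by
  have hinj : Function.Injective (fun y : Fin 2 → ℤ => (Fin.insertNth i m y : Site 3)) :=
    Fin.insertNth_right_injective (α := fun _ : Fin 3 => ℤ) (p := i) m
  have hs : Summable fun y : Fin 2 → ℤ => a (Fin.insertNth i m y : Site 3) :=
    ha.comp_injective hinj
  calc |∑' y : Fin 2 → ℤ, a (Fin.insertNth i m y : Site 3) * Real.cos (∑ j, k j * (y j : ℝ))|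
      ≤ ∑' y : Fin 2 → ℤ, |a (Fin.insertNth i m y : Site 3)| := abs_cosTransform_le hs k
    _ ≤ ∑' x : Site 3, |a x| :=
        tsum_comp_le_tsum_of_inj ha.abs (fun _ => abs_nonneg _) hinj

/-! ### The slab generating function: periodicity and coefficient extraction -/

/-- The slab generating function `θ ↦ Σ_x a(x) cos(θ x_i + k·x_⊥)` is `2π`-periodic. [folklore] -/
theorem slabGenerating_add_two_pi (a : Site 3 → ℝ) (i : Fin 3) (k : Fin 2 → ℝ) (θ : ℝ) :
    (∑' x : Site 3, a x * Real.cos ((θ + 2 * π) * (x i : ℝ) +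
        ∑ j : Fin 2, k j * (x (i.succAbove j) : ℝ))) =
      ∑' x : Site 3, a x * Real.cos (θ * (x i : ℝ) + ∑ j : Fin 2, k j * (x (i.succAbove j) : ℝ)) :=
  tsum_congr fun x => by
    rw [show (θ + 2 * π) * (x i : ℝ) + ∑ j : Fin 2, k j * (x (i.succAbove j) : ℝ) =
      θ * (x i : ℝ) + ∑ j : Fin 2, k j * (x (i.succAbove j) : ℝ) + ((x i : ℤ) : ℝ) * (2 * π) by ring,
      Real.cos_add_int_mul_two_pi]

/-- **Coefficient extraction (general phase).** For a summable `a : ℤ³ → ℝ` even in the `i`-th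
coordinate, a phase `φ` constant along the `i`-th coordinate on slabs (`φ(ins_i(m, y)) = ψ(y)`) and
`n ∈ ℕ`: `∫_{-π}^{π} (Σ_x a(x) cos(θ x_i + φ(x))) cos(nθ) dθ = 2π Σ_y a(ins_i(n, y)) cos(ψ(y))`
(termwise integration by the `ℓ¹` bound; by orthogonality only the slabs `x_i = ±n` survive, and they
contribute equally by evenness). [folklore] -/
theorem integral_tsum_cos_phase_mul_cos {a : Site 3 → ℝ} (ha : Summable a) (i : Fin 3)
    (hflip : ∀ x : Site 3, a (Function.update x i (-x i)) = a x) (φ : Site 3 → ℝ)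
    (ψ : (Fin 2 → ℤ) → ℝ) (hφ : ∀ (m : ℤ) (y : Fin 2 → ℤ), φ (Fin.insertNth i m y : Site 3) = ψ y)
    (n : ℕ) :
    (∫ θ in (-π : ℝ)..π, (∑' x : Site 3, a x * Real.cos (θ * (x i : ℝ) + φ x)) * Real.cos (n * θ)) =
      2 * π * ∑' y : Fin 2 → ℤ, a (Fin.insertNth i (n : ℤ) y : Site 3) * Real.cos (ψ y) := by
  -- the terms
  obtain ⟨G, hG⟩ : ∃ G : Site 3 → ℝ → ℝ,
      ∀ x θ, G x θ = a x * (Real.cos (θ * (x i : ℝ) + φ x) * Real.cos (n * θ)) :=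
    ⟨fun x θ => a x * (Real.cos (θ * (x i : ℝ) + φ x) * Real.cos (n * θ)), fun _ _ => rfl⟩
  have hle : (-π : ℝ) ≤ π := by linarith [Real.pi_pos]
  set μ : Measure ℝ := volume.restrict (Set.Icc (-π) π) with hμ
  haveI : IsFiniteMeasure μ := by rw [hμ]; infer_instance
  have hvol : μ.real Set.univ = 2 * π := by
    rw [hμ, measureReal_restrict_apply_univ, Real.volume_real_Icc_of_le hle]; ring
  -- the integrand as a series
  have hint_eq : ∀ θ : ℝ, (∑' x : Site 3, a x * Real.cos (θ * (x i : ℝ) + φ x)) * Real.cos (n * θ) =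
      ∑' x, G x θ := by
    intro θ
    rw [← tsum_mul_right]
    exact tsum_congr fun x => by rw [hG]; ring
  -- integrability and the `ℓ¹` bound
  have hGcont : ∀ x, Continuous (G x) := fun x => by
    have : G x = fun θ => a x * (Real.cos (θ * (x i : ℝ) + φ x) * Real.cos (n * θ)) :=
      funext (hG x)
    rw [this]
    fun_prop
  have hGint : ∀ x, Integrable (G x) μ := fun x => by
    rw [hμ]
    exact (hGcont x).integrableOn_Icc
  have hGnorm : ∀ x θ, ‖G x θ‖ ≤ |a x| := by
    intro x θ
    rw [hG, Real.norm_eq_abs, abs_mul, abs_mul]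
    exact mul_le_of_le_one_right (abs_nonneg _)
      (mul_le_one₀ (Real.abs_cos_le_one _) (abs_nonneg _) (Real.abs_cos_le_one _))
  have hGsum : Summable fun x => ∫ θ, ‖G x θ‖ ∂μ := by
    refine Summable.of_nonneg_of_le (fun x => integral_nonneg fun _ => norm_nonneg _) (fun x => ?_)
      (ha.abs.mul_right (2 * π))
    calc ∫ θ, ‖G x θ‖ ∂μ ≤ ∫ _θ, |a x| ∂μ :=
          integral_mono_of_nonneg (ae_of_all _ fun _ => norm_nonneg _) (integrable_const _)
            (ae_of_all _ (hGnorm x))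
      _ = |a x| * (2 * π) := by rw [integral_const, smul_eq_mul, hvol, mul_comm]
  -- termwise integrals: only the slabs `x_i = ±n` survive
  have hterm : ∀ x, ∫ θ, G x θ ∂μ = π * ((if x i = (n : ℤ) then a x * Real.cos (φ x) else 0) +
      (if x i = -(n : ℤ) then a x * Real.cos (φ x) else 0)) := by
    intro x
    simp_rw [hG]
    rw [integral_const_mul, hμ, integral_Icc_cos_add_mul_cos (x i) (φ x) n]
    split_ifs <;> ring
  have hbd : ∀ (m : ℤ) (x : Site 3), ‖(if x i = m then a x * Real.cos (φ x) else 0)‖ ≤ |a x| := by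
    intro m x
    split_ifs
    · rw [Real.norm_eq_abs, abs_mul]
      exact mul_le_of_le_one_right (abs_nonneg _) (Real.abs_cos_le_one _)
    · rw [norm_zero]; exact abs_nonneg _
  have hs1 : Summable fun x : Site 3 => (if x i = (n : ℤ) then a x * Real.cos (φ x) else 0) :=
    Summable.of_norm_bounded ha.abs (hbd n)
  have hs2 : Summable fun x : Site 3 => (if x i = -(n : ℤ) then a x * Real.cos (φ x) else 0) :=
    Summable.of_norm_bounded ha.abs (hbd (-n))
  -- the two surviving slabs, in slab coordinates
  have hslab1 : ∑' x : Site 3, (if x i = (n : ℤ) then a x * Real.cos (φ x) else 0) =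
      ∑' y : Fin 2 → ℤ, a (Fin.insertNth i (n : ℤ) y : Site 3) * Real.cos (ψ y) := by
    rw [tsum_ite_apply_eq_tsum_slab]
    exact tsum_congr fun y => by rw [hφ]
  have hslab2 : ∑' x : Site 3, (if x i = -(n : ℤ) then a x * Real.cos (φ x) else 0) =
      ∑' y : Fin 2 → ℤ, a (Fin.insertNth i (n : ℤ) y : Site 3) * Real.cos (ψ y) := by
    rw [tsum_ite_apply_eq_tsum_slab]
    refine tsum_congr fun y => ?_
    rw [hφ, ← update_insertNth_neg i (n : ℤ) y, hflip]
  -- assemble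
  rw [intervalIntegral.integral_of_le hle, ← integral_Icc_eq_integral_Ioc]
  simp_rw [hint_eq]
  rw [← hμ, ← integral_tsum_of_summable_integral_norm hGint hGsum, tsum_congr hterm, tsum_mul_left,
    Summable.tsum_add hs1 hs2, hslab1, hslab2]
  ring

/-- **Coefficient extraction for the slab generating function.** For a summable `a : ℤ³ → ℝ` even
in the `i`-th coordinate, a transverse momentum `k` and `n ∈ ℕ`:
`∫_{-π}^{π} (Σ_x a(x) cos(θ x_i + k·x_⊥)) cos(nθ) dθ = 2π Σ_y a(ins_i(n, y)) cos(k·y)`. [folklore] -/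
theorem integral_slabGenerating_mul_cos {a : Site 3 → ℝ} (ha : Summable a) (i : Fin 3)
    (hflip : ∀ x : Site 3, a (Function.update x i (-x i)) = a x) (k : Fin 2 → ℝ) (n : ℕ) :
    (∫ θ in (-π : ℝ)..π, (∑' x : Site 3, a x * Real.cos (θ * (x i : ℝ) +
        ∑ j : Fin 2, k j * (x (i.succAbove j) : ℝ))) * Real.cos (n * θ)) =
      2 * π * ∑' y : Fin 2 → ℤ, a (Fin.insertNth i (n : ℤ) y : Site 3) * Real.cos (∑ j, k j * (y j : ℝ)) :=
  integral_tsum_cos_phase_mul_cos ha i hflip (fun x => ∑ j : Fin 2, k j * (x (i.succAbove j) : ℝ))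
    (fun y => ∑ j, k j * (y j : ℝ)) (fun m y => by simp [Fin.insertNth_apply_succAbove]) n

/-! ### Strip analyticity ⇒ exponential decay of the slab modes -/

/-- **Strip analyticity of the slab generating function ⇒ exponential decay of the slab modes.**
Let `a : ℤ³ → ℝ` be summable and invariant under every coordinate sign flip, and let `c > 0`.
Suppose that for every direction `i` and every reduced transverse momentum `k ≠ 0` the slab generating
function `θ ↦ Σ_x a(x) cos(θ x_i + k·x_⊥)` is the real trace of a function holomorphic on the strip
`{|Im z| < c‖k‖}`.  Then `HasSlabModeExpDecay a` (expanded) holds with the constant `c`: for all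
reduced `k` and all `0 < c' < c`, eventually `Σ_y a(ins_i(n, y)) cos(k·y) ≤ C e^{-c'‖k‖n}`
(`k ≠ 0`: the extension is periodic and bounded by some `M` on `{|Im z| ≤ c'‖k‖}`
(`exists_norm_le_of_strip`), and coefficient extraction plus the contour shift give `C = M`;
`k = 0`: the trivial bound, `C = ‖a‖_{ℓ¹}`). [folklore] -/
theorem slabMode_le_exp_of_strip :
    ∀ (a : Site 3 → ℝ), Summable a → (∀ (j : Fin 3) (x : Site 3), a (Function.update x j (-x j)) = a x) →
    ∀ (c : ℝ), 0 < c →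
    (∀ (i : Fin 3) (k : Fin 2 → ℝ), (∀ j, |k j| ≤ Real.pi) → k ≠ 0 →
      ∃ Ψ : ℂ → ℂ, DifferentiableOn ℂ Ψ {z : ℂ | |z.im| < c * ‖k‖} ∧
        (∀ θ : ℝ, Ψ θ = ((∑' x : Site 3, a x * Real.cos (θ * (x i : ℝ) +
          ∑ j : Fin 2, k j * (x (i.succAbove j) : ℝ)) : ℝ) : ℂ))) →
    ∃ c₀ : ℝ, 0 < c₀ ∧ ∀ (i : Fin 3) (k : Fin 2 → ℝ), (∀ j, |k j| ≤ Real.pi) → ∀ c' : ℝ, 0 < c' →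
      c' < c₀ → ∃ C : ℝ, ∀ᶠ n : ℕ in Filter.atTop, (∑' y : Fin 2 → ℤ, a (Fin.insertNth i (n : ℤ) (y) :
        Site 3) * Real.cos (∑ j, k j * (y j : ℝ))) ≤ C * Real.exp (-(c' * ‖k‖ * (n : ℝ))) := by
  intro a ha hflip c hc hΨ
  refine ⟨c, hc, fun i k hk c' hc'0 hc'c => ?_⟩
  by_cases hk0 : k = 0
  · -- `k = 0`: the trivial `ℓ¹` bound
    refine ⟨∑' x : Site 3, |a x|, Filter.Eventually.of_forall fun n => ?_⟩
    rw [hk0, norm_zero, mul_zero, zero_mul, neg_zero, Real.exp_zero, mul_one]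
    exact (le_abs_self _).trans (abs_slabMode_le_tsum_abs ha i (n : ℤ) 0)
  · -- `k ≠ 0`: coefficient extraction and the Paley–Wiener bound
    have hkpos : 0 < ‖k‖ := norm_pos_iff.mpr hk0
    obtain ⟨Ψ, hΨd, hΨtr⟩ := hΨ i k hk hk0
    have hb : 0 < c * ‖k‖ := mul_pos hc hkpos
    have hy0 : 0 ≤ c' * ‖k‖ := by positivity
    have hy : c' * ‖k‖ < c * ‖k‖ := mul_lt_mul_of_pos_right hc'c hkpos
    -- the extension is `2π`-periodic on `ℝ`, hence bounded on the closed sub-strip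
    have hperΨ : ∀ θ : ℝ, Ψ (θ + 2 * π) = Ψ θ := fun θ => by
      have e : ((θ + 2 * π : ℝ) : ℂ) = (θ : ℂ) + 2 * (π : ℂ) := by push_cast; ring
      rw [← e, hΨtr, hΨtr, slabGenerating_add_two_pi]
    obtain ⟨M, hM⟩ := exists_norm_le_of_strip hb hΨd hperΨ hy
    refine ⟨M, Filter.Eventually.of_forall fun n => ?_⟩
    have hPW := abs_integral_mul_cos_le_of_strip
      (f := fun θ : ℝ => ∑' x : Site 3, a x * Real.cos (θ * (x i : ℝ) +
        ∑ j : Fin 2, k j * (x (i.succAbove j) : ℝ)))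
      hb hΨd hΨtr (slabGenerating_add_two_pi a i k) n hy0 hy hM
    rw [integral_slabGenerating_mul_cos ha i (hflip i) k n, abs_mul,
      abs_of_pos Real.two_pi_pos] at hPW
    have h2 : |∑' y : Fin 2 → ℤ, a (Fin.insertNth i (n : ℤ) y : Site 3) * Real.cos (∑ j, k j * (y j : ℝ))|
        ≤ M * Real.exp (-(n * (c' * ‖k‖))) :=
      le_of_mul_le_mul_left (by linarith [hPW]) Real.two_pi_pos
    calc (∑' y : Fin 2 → ℤ, a (Fin.insertNth i (n : ℤ) y : Site 3) * Real.cos (∑ j, k j * (y j : ℝ)))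
        ≤ M * Real.exp (-(n * (c' * ‖k‖))) := (le_abs_self _).trans h2
      _ = M * Real.exp (-(c' * ‖k‖ * (n : ℝ))) := by ring_nf

/-- **Registered sub-stub `stub_slabModeExpDecay_auxPaleyWiener`** (brick of `stub_slabModeExpDecay`,
line `self-energy-pick-inversion`): THE PALEY–WIENER INTERFACE, in the form of the lead's brief (with
the boundedness of the extension on closed sub-strips as an extra — redundant, see
`slabMode_le_exp_of_strip` — hypothesis).  If for every direction `i` and every reduced transverse
momentum `k ≠ 0` the slab generating function `θ ↦ Σ_x a(x) cos(θ x_i + k·x_⊥)` of a summable,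
sign-flip invariant `a : ℤ³ → ℝ` extends to a function holomorphic on `{|Im z| < c‖k‖}` and bounded on
every closed sub-strip, then `HasSlabModeExpDecay a` (expanded) holds with the constant `c`. [folklore] -/
theorem stub_slabModeExpDecay_auxPaleyWiener :
    ∀ (a : Site 3 → ℝ), Summable a → (∀ (j : Fin 3) (x : Site 3), a (Function.update x j (-x j)) = a x) →
    ∀ (c : ℝ), 0 < c →
    (∀ (i : Fin 3) (k : Fin 2 → ℝ), (∀ j, |k j| ≤ Real.pi) → k ≠ 0 →
      ∃ Ψ : ℂ → ℂ, DifferentiableOn ℂ Ψ {z : ℂ | |z.im| < c * ‖k‖} ∧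
        (∀ θ : ℝ, Ψ θ = ((∑' x : Site 3, a x * Real.cos (θ * (x i : ℝ) +
          ∑ j : Fin 2, k j * (x (i.succAbove j) : ℝ)) : ℝ) : ℂ)) ∧
        (∀ c' : ℝ, 0 < c' → c' < c → ∃ M : ℝ, ∀ z : ℂ, |z.im| ≤ c' * ‖k‖ → ‖Ψ z‖ ≤ M)) →
    ∃ c₀ : ℝ, 0 < c₀ ∧ ∀ (i : Fin 3) (k : Fin 2 → ℝ), (∀ j, |k j| ≤ Real.pi) → ∀ c' : ℝ, 0 < c' →
      c' < c₀ → ∃ C : ℝ, ∀ᶠ n : ℕ in Filter.atTop, (∑' y : Fin 2 → ℤ, a (Fin.insertNth i (n : ℤ) (y) :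
        Site 3) * Real.cos (∑ j, k j * (y j : ℝ))) ≤ C * Real.exp (-(c' * ‖k‖ * (n : ℝ))) :=
  fun a ha hflip c hc hΨ => slabMode_le_exp_of_strip a ha hflip c hc fun i k hk hk0 =>
    (hΨ i k hk hk0).imp fun _ h => ⟨h.1, h.2.1⟩

end Summit.CriticalPhenomena.Ising3DConformalLimit.Cruxes.DirectCorrelationStableTail.SelfEnergyPickInversion

end
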